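import Summits.ResolutionOfSingularities.ResolutionOfSingularities.Theorems.ValuativeLuAlphaPTorsorToroidalExitPresentation

/-!
# `Valuative.LuAlphaPTorsor`, toroidal exit — helper file 2: the regularity engine

Route `ResolutionOfSingularities/Valuative`, crux `LuAlphaPTorsor` (stmt-0641), line
`pfaff-line-log-final-forms`, stub `stub_toroidalExit`.

**The engine** (`isRegularLocalRing_of_presentation`). Let `A₁ ≤ A` be finitely generated
`k`-subalgebras of a field `K` of the same Krull dimension (e.g. `A` algebraic over `A₁`),
`𝔮 ⊂ A` a prime with `𝔭 = 𝔮 ∩ A₁` of height `d`, and suppose `A = A₁[x_i : i ∈ σ]` for finitely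
many `x_i`. Let `I₁ ⊆ I₀ ⊆ σ` with `x_i ∈ 𝔮` for `i ∈ I₁`, such that in `S = A_𝔮`:
(i) `𝔪_{(A₁)_𝔭} S ⊆ (x_i : i ∈ I₁) S`; (ii) for `i ∈ I₀`, `x_i ≡ r_i` modulo `(x_i : i ∈ I₁) S`
for some `r_i ∈ (A₁)_𝔭`. If `#I₁ + #σ ≤ d + #I₀` then `A_𝔮` is a regular local ring.

*Proof.* Count generators: `μ(𝔪_S) ≤ #I₁ + μ(𝔪_{S/(x_{I₁})})` and, `S/(x_{I₁})` being
essentially a quotient of `κ(𝔭)[X_σ]` in which the `X_i`, `i ∈ I₀`, may be specialised to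
constants, `μ(𝔪_{S/(x_{I₁})}) + #I₀ ≤ h`, `h` the height of the corresponding prime of
`κ(𝔭)[X_σ]` (helper file 1). Count dimensions: `ht 𝔮 + #σ = ht 𝔔` for the prime `𝔔` of
`A₁[X_σ]` above `𝔮` (affine dimension formula, tree `AffineCatenary.lean`), `ht 𝔔` is unchanged
in the localisation `(A₁)_𝔭[X_σ]`, and there going-down for the free extension
`(A₁)_𝔭 → (A₁)_𝔭[X_σ]` (Mathlib) gives `ht 𝔔 = d + h` with the SAME `h` (the fibre ring
`(A₁)_𝔭[X_σ]/𝔪` is `κ(𝔭)[X_σ]`). Hence `μ(𝔪_S) ≤ #I₁ + h - #I₀ ≤ d + h - #σ = dim S`.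

Also here (§1): the embeddings of the local rings `(A₁)_𝔭`, `A_𝔮` into `K` and their
compatibility, used by the stub to verify (i) and (ii) inside `K`.
-/

noncomputable section

-- `Summit.<S>.<S>.…` duplicates the summit name by design (D-0017, single-problem summit).
set_option linter.dupNamespace false

open IsLocalRing MvPolynomial

namespace Summit.ResolutionOfSingularities.ResolutionOfSingularities.Theorems.PfaffLine

/-! ## §1 Local rings of models inside `K` -/

section Embedding

variable {K : Type} [Field K]

/-- The elements of the complement of a prime ideal of a subring `A ⊆ K` are units of `K`. -/
theorem isUnit_algebraMap_primeCompl (A : Subring K) (𝔮 : Ideal A) [𝔮.IsPrime]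
    (s : 𝔮.primeCompl) : IsUnit (algebraMap A K s) := by
  rw [isUnit_iff_ne_zero]
  intro h0
  apply s.2
  have : (s : A) = 0 := Subtype.ext h0
  rw [this]
  exact 𝔮.zero_mem

/-- The embedding `A_𝔮 → K` of the local ring of a subring `A ⊆ K` at a prime. -/
def locToField (A : Subring K) (𝔮 : Ideal A) [𝔮.IsPrime] : Localization.AtPrime 𝔮 →+* K :=
  IsLocalization.lift (isUnit_algebraMap_primeCompl A 𝔮)

/-- `locToField` extends the inclusion `A ⊆ K`. -/
theorem locToField_algebraMap (A : Subring K) (𝔮 : Ideal A) [𝔮.IsPrime] (a : A) :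
    locToField A 𝔮 (algebraMap A _ a) = a :=
  IsLocalization.lift_eq _ a

/-- `locToField` on fractions. -/
theorem locToField_mk' (A : Subring K) (𝔮 : Ideal A) [𝔮.IsPrime] (a : A) (s : 𝔮.primeCompl) :
    locToField A 𝔮 (IsLocalization.mk' _ a s) = a * ((s : A) : K)⁻¹ := by
  have hs0 : ((s : A) : K) ≠ 0 := fun h0 => s.2 (by
    rw [show (s : A) = 0 from Subtype.ext h0]; exact 𝔮.zero_mem)
  apply (IsLocalization.lift_mk'_spec _ a _ s).mpr
  change (a : K) = (s : K) * ((a : K) * ((s : A) : K)⁻¹)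
  field_simp

/-- `locToField` is injective. -/
theorem locToField_injective (A : Subring K) (𝔮 : Ideal A) [𝔮.IsPrime] :
    Function.Injective (locToField A 𝔮) := by
  refine (IsLocalization.lift_injective_iff _).mpr fun x y => ⟨fun h => ?_, fun h => ?_⟩
  · rw [IsLocalization.injective (Localization.AtPrime 𝔮) 𝔮.primeCompl_le_nonZeroDivisors h]
  · rw [show x = y from Subtype.ext h]

/-- Elements of `A_𝔮` inside `K` are fractions `a / s`, `a ∈ A`, `s ∈ A ∖ 𝔮`. -/
theorem locToField_eq (A : Subring K) (𝔮 : Ideal A) [𝔮.IsPrime]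
    (r : Localization.AtPrime 𝔮) :
    ∃ (a : A) (s : A), s ∉ 𝔮 ∧ (s : K) ≠ 0 ∧ locToField A 𝔮 r = a * (s : K)⁻¹ := by
  obtain ⟨⟨a, s⟩, rfl⟩ := IsLocalization.mk'_surjective 𝔮.primeCompl r
  have hs0 : ((s : A) : K) ≠ 0 := fun h0 => s.2 (by
    rw [show (s : A) = 0 from Subtype.ext h0]; exact 𝔮.zero_mem)
  exact ⟨a, s, s.2, hs0, locToField_mk' A 𝔮 a s⟩

/-- **Compatibility.** For subrings `A₁ ≤ A` and primes `𝔭 = 𝔮 ∩ A₁`, the canonical local map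
`(A₁)_𝔭 → A_𝔮` commutes with the embeddings into `K`. -/
theorem locToField_localRingHom {A₁ A : Subring K} (hle : A₁ ≤ A) (𝔮 : Ideal A)
    [𝔮.IsPrime] (𝔭 : Ideal A₁) [𝔭.IsPrime]
    (h𝔭 : 𝔭 = 𝔮.comap (Subring.inclusion hle)) (r : Localization.AtPrime 𝔭) :
    locToField A 𝔮 (Localization.localRingHom 𝔭 𝔮 _ h𝔭 r) = locToField A₁ 𝔭 r := by
  have : (locToField A 𝔮).comp (Localization.localRingHom 𝔭 𝔮 _ h𝔭) = locToField A₁ 𝔭 := by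
    refine IsLocalization.ringHom_ext 𝔭.primeCompl ?_
    ext a
    simp only [RingHom.coe_comp, Function.comp_apply, Localization.localRingHom_to_map,
      locToField_algebraMap]
    rfl
  exact congrArg (fun f => f r) this

/-- Transfer of identities from `K` to `A_𝔮`: if `r ∈ (A₁)_𝔭` and `y ∈ A` agree inside `K`, the
image of `r` in `A_𝔮` is the image of `y`. -/
theorem localRingHom_eq_algebraMap {A₁ A : Subring K} (hle : A₁ ≤ A) (𝔮 : Ideal A)
    [𝔮.IsPrime] (𝔭 : Ideal A₁) [𝔭.IsPrime]
    (h𝔭 : 𝔭 = 𝔮.comap (Subring.inclusion hle)) (r : Localization.AtPrime 𝔭)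
    (y : A) (h : locToField A₁ 𝔭 r = y) :
    Localization.localRingHom 𝔭 𝔮 _ h𝔭 r = algebraMap A (Localization.AtPrime 𝔮) y := by
  apply locToField_injective A 𝔮
  rw [locToField_localRingHom, h, locToField_algebraMap]

end Embedding

/-! ## §2 The regularity engine -/

section Engine

attribute [local instance] MvPolynomial.algebraMvPolynomial

/-- **The regularity engine of the toroidal exit** (see the module docstring), for abstract
affine domains `ι : A₁ ↪ A` over a field `k` with `A` algebraic over `A₁`: the local ring `A_𝔮` of
`A = A₁[x_σ]` is regular as soon as, with `S = A_𝔮` and `𝔭 = ι⁻¹ 𝔮` of height `d`: the `x_i`,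
`i ∈ I₁`, lie in `𝔮` and generate an ideal of `S` containing the image of `𝔪_{(A₁)_𝔭}` and,
for `i ∈ I₀`, the class of `x_i` up to an element of `(A₁)_𝔭`; and `#I₁ + #σ ≤ d + #I₀`.
(Generator count against the dimension count through `(A₁)_𝔭[X_σ]`: helper file 1, the affine
dimension formula, and going-down for flat extensions.) -/
theorem isRegularLocalRing_of_presentation : ∀ {k : Type} [Field k] {A₁ A : Type} [CommRing A₁] [CommRing A] [IsDomain A₁] [IsDomain A] [Algebra k A₁] [Algebra k A] [Algebra.FiniteType k A₁] [Algebra.FiniteType k A] (ι : A₁ →+* A), Function.Injective ι → (∀ c, ι (algebraMap k A₁ c) = algebraMap k A c) → (∀ y : A, ∃ f : Polynomial A₁, f ≠ 0 ∧ Polynomial.eval₂ ι y f = 0) → ∀ (𝔮 : Ideal A) [𝔮.IsPrime] (𝔭 : Ideal A₁) [𝔭.IsPrime] (h𝔭 : 𝔭 = 𝔮.comap ι) (d : ℕ), ringKrullDim (Localization.AtPrime 𝔭) = d → ∀ {σ : Type} [Fintype σ] (x : σ → A), Function.Surjective (MvPolynomial.eval₂Hom ι x) → ∀ (I₁ I₀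 : Finset σ), (∀ i ∈ I₁, x i ∈ 𝔮) → (∀ r ∈ IsLocalRing.maximalIdeal (Localization.AtPrime 𝔭), Localization.localRingHom 𝔭 𝔮 ι h𝔭 r ∈ Ideal.span ((fun i => algebraMap A (Localization.AtPrime 𝔮) (x i)) '' I₁)) → (∀ i ∈ I₀, ∃ r : Localization.AtPrime 𝔭, algebraMap A (Localization.AtPrime 𝔮) (x i) - Localization.localRingHom 𝔭 𝔮 ι h𝔭 r ∈ Ideal.span ((fun i => algebraMap A (Localization.AtPrime 𝔮) (x i)) '' I₁)) → I₁.card + Fintype.card σ ≤ d + I₀.card → IsRegularLocalRing (Localization.AtPrime 𝔮) := by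
  intro k _ A₁ A _ _ _ _ _ _ _ _ ι hι hιk halg 𝔮 _ 𝔭 _ h𝔭 d hd σ _ x hsurj I₁ I₀ hI₁ hmax hI₀ hcount
  classical
  haveI : IsNoetherianRing A := Algebra.FiniteType.isNoetherianRing k A
  haveI : IsNoetherianRing A₁ := Algebra.FiniteType.isNoetherianRing k A₁
  -- ### `dim A = dim A₁` (`A` is algebraic over `A₁`; dimension = transcendence degree)
  have hdimA : ringKrullDim A = ringKrullDim A₁ := by
    letI : Algebra A₁ A := ι.toAlgebra
    haveI : IsScalarTower k A₁ A := IsScalarTower.of_algebraMap_eq fun c => (hιk c).symm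
    haveI : Algebra.IsAlgebraic A₁ A :=
      ⟨fun y => by obtain ⟨f, hf, hfy⟩ := halg y; exact ⟨f, hf, hfy⟩⟩
    haveI : FaithfulSMul A₁ A := (faithfulSMul_iff_algebraMap_injective A₁ A).mpr hι
    haveI : FaithfulSMul k A₁ :=
      (faithfulSMul_iff_algebraMap_injective k A₁).mpr (algebraMap k A₁).injective
    have h := trdeg_add_eq k A₁ (A := A)
    rw [trdeg_eq_zero (R := A₁) (A := A), add_zero] at h
    rw [Literature.RingTheory.KrullDimension.ringKrullDim_eq_trdeg k A,
      Literature.RingTheory.KrullDimension.ringKrullDim_eq_trdeg k A₁, h]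
  let ℓ : Localization.AtPrime 𝔭 →+* Localization.AtPrime 𝔮 := Localization.localRingHom 𝔭 𝔮 ι h𝔭
  let xS : σ → Localization.AtPrime 𝔮 := fun i => algebraMap A (Localization.AtPrime 𝔮) (x i)
  -- ### the presentation `Ψ : A₁[X_σ] ↠ A` and the prime `𝔔` above `𝔮`
  let Ψ : MvPolynomial σ A₁ →+* A := MvPolynomial.eval₂Hom ι x
  let 𝔔 : Ideal (MvPolynomial σ A₁) := 𝔮.comap Ψ
  haveI h𝔔 : 𝔔.IsPrime := Ideal.comap_isPrime Ψ 𝔮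
  -- `ht 𝔮 + #σ = ht 𝔔` (affine dimension formula)
  obtain ⟨n₁, hn₁, -⟩ :=
    Literature.RingTheory.KrullDimension.exists_ringKrullDim_eq_and_trdeg_eq k A₁
  haveI : Algebra.FiniteType k (A ⧸ 𝔮) :=
    Algebra.FiniteType.of_surjective (Ideal.Quotient.mkₐ k 𝔮) Ideal.Quotient.mk_surjective
  obtain ⟨n₂, hn₂, -⟩ :=
    Literature.RingTheory.KrullDimension.exists_ringKrullDim_eq_and_trdeg_eq k (A ⧸ 𝔮)
  have hdim𝔔 := Literature.RingTheory.KrullDimension.ringKrullDim_quotient_add_height k 𝔔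
  have hdim𝔮 := Literature.RingTheory.KrullDimension.ringKrullDim_quotient_add_height k 𝔮
  have he𝔔 : ringKrullDim (MvPolynomial σ A₁ ⧸ 𝔔) = ringKrullDim (A ⧸ 𝔮) := by
    let g : MvPolynomial σ A₁ →+* A ⧸ 𝔮 := (Ideal.Quotient.mk 𝔮).comp Ψ
    have hg : Function.Surjective g := Ideal.Quotient.mk_surjective.comp hsurj
    have hker : RingHom.ker g = 𝔔 := by
      rw [← RingHom.comap_ker, Ideal.mk_ker]
    exact ringKrullDim_eq_of_ringEquiv
      ((Ideal.quotEquivOfEq hker.symm).trans (RingHom.quotientKerEquivOfSurjective hg))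
  rw [he𝔔, hn₂, MvPolynomial.ringKrullDim_of_isNoetherianRing, hn₁,
    Nat.card_eq_fintype_card] at hdim𝔔
  rw [hn₂, hdimA, hn₁] at hdim𝔮
  obtain ⟨a𝔔, ha𝔔⟩ := ENat.ne_top_iff_exists.mp (Ideal.height_ne_top_of_isPrime (I := 𝔔))
  obtain ⟨a𝔮, ha𝔮⟩ := ENat.ne_top_iff_exists.mp (Ideal.height_ne_top_of_isPrime (I := 𝔮))
  rw [← ha𝔔] at hdim𝔔
  rw [← ha𝔮] at hdim𝔮
  have e1 : n₂ + a𝔔 = n₁ + Fintype.card σ := by exact_mod_cast hdim𝔔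
  have e2 : n₂ + a𝔮 = n₁ := by exact_mod_cast hdim𝔮
  -- ### the localised presentation `(A₁)_𝔭[X_σ] → S` and the prime `𝔔R`
  let ΨR : MvPolynomial σ (Localization.AtPrime 𝔭) →+* Localization.AtPrime 𝔮 :=
    MvPolynomial.eval₂Hom ℓ xS
  have hsq : ΨR.comp (algebraMap (MvPolynomial σ A₁) (MvPolynomial σ (Localization.AtPrime 𝔭)))
      = (algebraMap A (Localization.AtPrime 𝔮)).comp Ψ := by
    refine MvPolynomial.ringHom_ext (fun a => ?_) (fun i => ?_)
    · rw [RingHom.comp_apply, RingHom.comp_apply, MvPolynomial.algebraMap_def,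
        MvPolynomial.map_C]
      simp only [ΨR, Ψ, MvPolynomial.eval₂Hom_C]
      exact Localization.localRingHom_to_map 𝔭 𝔮 ι h𝔭 a
    · simp [ΨR, Ψ, xS]
  let 𝔔R : Ideal (MvPolynomial σ (Localization.AtPrime 𝔭)) :=
    (maximalIdeal (Localization.AtPrime 𝔮)).comap ΨR
  haveI h𝔔R : 𝔔R.IsPrime := Ideal.comap_isPrime ΨR _
  have hunder : 𝔔R.under (MvPolynomial σ A₁) = 𝔔 := by
    change (𝔔R).comap (algebraMap (MvPolynomial σ A₁) (MvPolynomial σ (Localization.AtPrime 𝔭)))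
      = 𝔔
    rw [Ideal.comap_comap, hsq, ← Ideal.comap_comap]
    change ((maximalIdeal (Localization.AtPrime 𝔮)).under A).comap Ψ = 𝔔
    rw [Localization.AtPrime.under_maximalIdeal]
  have hht : 𝔔.height = 𝔔R.height := by
    have := IsLocalization.height_under (𝔭.primeCompl.map (C (σ := σ))) 𝔔R
    rw [hunder] at this
    exact this
  -- ### going-down for `R → R[X_σ]`: `ht 𝔔R = d + h`
  haveI : 𝔔R.LiesOver (maximalIdeal (Localization.AtPrime 𝔭)) := by
    refine ⟨?_⟩
    change maximalIdeal (Localization.AtPrime 𝔭) =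
      𝔔R.comap (algebraMap (Localization.AtPrime 𝔭) (MvPolynomial σ (Localization.AtPrime 𝔭)))
    rw [Ideal.comap_comap]
    have : ΨR.comp (algebraMap (Localization.AtPrime 𝔭)
        (MvPolynomial σ (Localization.AtPrime 𝔭))) = ℓ :=
      MvPolynomial.eval₂Hom_comp_C ℓ xS
    rw [this, IsLocalRing.maximalIdeal_comap]
  have hgd := Ideal.height_eq_height_add_of_liesOver_of_hasGoingDown
    (maximalIdeal (Localization.AtPrime 𝔭)) 𝔔R
  have hdR : (maximalIdeal (Localization.AtPrime 𝔭)).height = d := by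
    have := IsLocalRing.maximalIdeal_height_eq_ringKrullDim (R := Localization.AtPrime 𝔭)
    rw [hd] at this
    exact_mod_cast this
  rw [hdR] at hgd
  generalize h𝔪T : Ideal.map (algebraMap (Localization.AtPrime 𝔭)
    (MvPolynomial σ (Localization.AtPrime 𝔭))) (maximalIdeal (Localization.AtPrime 𝔭)) = 𝔪T at hgd
  -- ### the quotient `Ā = S / (x_i : i ∈ I₁)` and the residue field `κ = κ(𝔭)`
  obtain ⟨𝔞, h𝔞⟩ : ∃ 𝔞 : Ideal (Localization.AtPrime 𝔮), Ideal.span (xS '' ↑I₁) = 𝔞 := ⟨_, rfl⟩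
  have hmax𝔞 : ∀ r ∈ maximalIdeal (Localization.AtPrime 𝔭), ℓ r ∈ 𝔞 := fun r hr =>
    h𝔞 ▸ hmax r hr
  have hI₀𝔞 : ∀ i ∈ I₀, ∃ r : Localization.AtPrime 𝔭, xS i - ℓ r ∈ 𝔞 := fun i hi =>
    h𝔞 ▸ hI₀ i hi
  have h𝔞le : 𝔞 ≤ maximalIdeal (Localization.AtPrime 𝔮) := by
    rw [← h𝔞, Ideal.span_le]
    rintro _ ⟨i, hi, rfl⟩
    exact (IsLocalization.AtPrime.to_map_mem_maximal_iff (Localization.AtPrime 𝔮) 𝔮 _).mpr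
      (hI₁ i hi)
  have h𝔞top : 𝔞 ≠ ⊤ := fun h =>
    (maximalIdeal.isMaximal (Localization.AtPrime 𝔮)).ne_top (top_le_iff.mp (h ▸ h𝔞le))
  haveI : Nontrivial (Localization.AtPrime 𝔮 ⧸ 𝔞) := Ideal.Quotient.nontrivial_iff.mpr h𝔞top
  haveI : IsLocalRing (Localization.AtPrime 𝔮 ⧸ 𝔞) :=
    IsLocalRing.of_surjective' (Ideal.Quotient.mk 𝔞) Ideal.Quotient.mk_surjective
  -- `μ(𝔪_S) ≤ #I₁ + μ(𝔪_Ā)`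
  have hμ₁ : (maximalIdeal (Localization.AtPrime 𝔮)).spanFinrank ≤
      I₁.card + (maximalIdeal (Localization.AtPrime 𝔮 ⧸ 𝔞)).spanFinrank := by
    have h𝔞' : Ideal.span ((I₁.image xS : Finset (Localization.AtPrime 𝔮)) :
        Set (Localization.AtPrime 𝔮)) = 𝔞 := by
      rw [Finset.coe_image, h𝔞]
    have hY : ((I₁.image xS : Finset (Localization.AtPrime 𝔮)) : Set (Localization.AtPrime 𝔮))
        ⊆ maximalIdeal (Localization.AtPrime 𝔮) := by
      rw [Finset.coe_image, ← Ideal.span_le, h𝔞]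
      exact h𝔞le
    have h := spanFinrank_maximalIdeal_le_card_add 𝔞 (I₁.image xS) h𝔞' hY
    have hc : (I₁.image xS).card ≤ I₁.card := Finset.card_image_le
    omega
  -- the residue field `κ` and `φ : κ[X_σ] → Ā`
  have hmax' : ∀ r ∈ maximalIdeal (Localization.AtPrime 𝔭),
      ((Ideal.Quotient.mk 𝔞).comp ℓ) r = 0 := fun r hr =>
    Ideal.Quotient.eq_zero_iff_mem.mpr (hmax𝔞 r hr)
  let θ : ResidueField (Localization.AtPrime 𝔭) →+* Localization.AtPrime 𝔮 ⧸ 𝔞 :=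
    Ideal.Quotient.lift (maximalIdeal (Localization.AtPrime 𝔭)) ((Ideal.Quotient.mk 𝔞).comp ℓ)
      hmax'
  have hθ : ∀ r, θ (residue (Localization.AtPrime 𝔭) r) = Ideal.Quotient.mk 𝔞 (ℓ r) := fun r =>
    Ideal.Quotient.lift_mk _ _ _
  let φ : MvPolynomial σ (ResidueField (Localization.AtPrime 𝔭)) →+* Localization.AtPrime 𝔮 ⧸ 𝔞 :=
    MvPolynomial.eval₂Hom θ (fun i => Ideal.Quotient.mk 𝔞 (xS i))
  let Φ : MvPolynomial σ (Localization.AtPrime 𝔭) →+* Localization.AtPrime 𝔮 ⧸ 𝔞 :=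
    (Ideal.Quotient.mk 𝔞).comp ΨR
  have hφΦ : φ.comp (MvPolynomial.map (residue (Localization.AtPrime 𝔭))) = Φ := by
    refine MvPolynomial.ringHom_ext (fun r => ?_) (fun i => ?_)
    · simp only [RingHom.coe_comp, Function.comp_apply, MvPolynomial.map_C, φ,
        MvPolynomial.eval₂Hom_C, hθ, Φ, ΨR]
    · simp [φ, Φ, ΨR]
  -- `φ` is essentially surjective
  have hev : ∀ P : MvPolynomial σ A₁,
      φ (MvPolynomial.map ((residue (Localization.AtPrime 𝔭)).comp
        (algebraMap A₁ (Localization.AtPrime 𝔭))) P) =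
      Ideal.Quotient.mk 𝔞 (algebraMap A (Localization.AtPrime 𝔮) (Ψ P)) := by
    intro P
    rw [← MvPolynomial.map_map, ← MvPolynomial.algebraMap_def,
      ← RingHom.comp_apply (hnp := φ) (hmn := MvPolynomial.map (residue (Localization.AtPrime 𝔭))),
      hφΦ]
    change Ideal.Quotient.mk 𝔞 (ΨR (algebraMap _ _ P)) = _
    rw [← RingHom.comp_apply (hnp := ΨR), hsq]
    rfl
  have hφ : ∀ b : Localization.AtPrime 𝔮 ⧸ 𝔞, ∃ f g, IsUnit (φ g) ∧ φ f = b * φ g := by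
    intro b
    obtain ⟨s₀, rfl⟩ := Ideal.Quotient.mk_surjective b
    obtain ⟨⟨a, s⟩, rfl⟩ := IsLocalization.mk'_surjective 𝔮.primeCompl s₀
    obtain ⟨Pa, hPa⟩ := hsurj a
    obtain ⟨Ps, hPs⟩ := hsurj s
    refine ⟨MvPolynomial.map ((residue _).comp (algebraMap A₁ (Localization.AtPrime 𝔭))) Pa,
      MvPolynomial.map ((residue _).comp (algebraMap A₁ (Localization.AtPrime 𝔭))) Ps, ?_, ?_⟩
    · rw [hev]
      change IsUnit (Ideal.Quotient.mk 𝔞 (algebraMap A (Localization.AtPrime 𝔮) (Ψ Ps)))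
      rw [hPs]
      exact ((IsLocalization.map_units (Localization.AtPrime 𝔮) s).map (Ideal.Quotient.mk 𝔞))
    · rw [hev, hev]
      change Ideal.Quotient.mk 𝔞 (algebraMap A (Localization.AtPrime 𝔮) (Ψ Pa)) =
        _ * Ideal.Quotient.mk 𝔞 (algebraMap A (Localization.AtPrime 𝔮) (Ψ Ps))
      rw [hPa, hPs, ← map_mul, IsLocalization.mk'_spec]
  -- the specialised variables
  have hI₀' : ∀ i, ∃ r : Localization.AtPrime 𝔭, i ∈ I₀ → xS i - ℓ r ∈ 𝔞 := fun i => by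
    by_cases hi : i ∈ I₀
    · obtain ⟨r, hr⟩ := hI₀𝔞 i hi
      exact ⟨r, fun _ => hr⟩
    · exact ⟨0, fun h => absurd h hi⟩
  choose rc hrc using hI₀'
  let c : σ → ResidueField (Localization.AtPrime 𝔭) := fun i => residue _ (rc i)
  have hc : ∀ i ∈ I₀, φ (X i) = φ (C (c i)) := by
    intro i hi
    simp only [φ, c, MvPolynomial.eval₂Hom_X', MvPolynomial.eval₂Hom_C, hθ]
    exact (Ideal.Quotient.eq).mpr (hrc i hi)
  have hμ₂ := spanFinrank_add_card_le_height φ hφ I₀ c hc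
  -- ### identification of the fibre prime: `ht (φ⁻¹ 𝔪_Ā) = ht (𝔔R / 𝔪 R[X_σ])`
  have hkerres : RingHom.ker (MvPolynomial.map (σ := σ) (residue (Localization.AtPrime 𝔭)))
      = 𝔪T := by
    rw [MvPolynomial.ker_map, IsLocalRing.ker_residue, ← h𝔪T, MvPolynomial.algebraMap_eq]
  let ē : (MvPolynomial σ (Localization.AtPrime 𝔭) ⧸ 𝔪T) ≃+*
      MvPolynomial σ (ResidueField (Localization.AtPrime 𝔭)) :=
    (Ideal.quotEquivOfEq hkerres.symm).trans (RingHom.quotientKerEquivOfSurjective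
      (MvPolynomial.map_surjective (residue _) Ideal.Quotient.mk_surjective))
  have hē : ∀ P, ē (Ideal.Quotient.mk 𝔪T P) = MvPolynomial.map (residue _) P := fun P => by
    simp [ē, RingHom.quotientKerEquivOfSurjective_apply_mk]
  have hΦfac : Φ = (φ.comp ē.toRingHom).comp (Ideal.Quotient.mk 𝔪T) := by
    rw [← hφΦ]
    refine RingHom.ext fun P => ?_
    simp only [RingHom.coe_comp, Function.comp_apply]
    rw [show ē.toRingHom (Ideal.Quotient.mk 𝔪T P) = ē (Ideal.Quotient.mk 𝔪T P) from rfl, hē]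
  have hcomapΦ : (maximalIdeal (Localization.AtPrime 𝔮 ⧸ 𝔞)).comap Φ = 𝔔R := by
    change ((maximalIdeal _).comap ((Ideal.Quotient.mk 𝔞).comp ΨR)) = (maximalIdeal _).comap ΨR
    rw [← Ideal.comap_comap]
    congr 1
    haveI := Ideal.comap_isMaximal_of_surjective (Ideal.Quotient.mk 𝔞)
      Ideal.Quotient.mk_surjective (K := maximalIdeal (Localization.AtPrime 𝔮 ⧸ 𝔞))
    exact IsLocalRing.eq_maximalIdeal this
  have h1 : 𝔔R.map (Ideal.Quotient.mk 𝔪T) =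
      ((maximalIdeal (Localization.AtPrime 𝔮 ⧸ 𝔞)).comap φ).comap ē.toRingHom := by
    rw [← hcomapΦ, hΦfac, ← Ideal.comap_comap, ← Ideal.comap_comap,
      Ideal.map_comap_of_surjective _ Ideal.Quotient.mk_surjective]
  have h2 : (𝔔R.map (Ideal.Quotient.mk 𝔪T)).map ē =
      (maximalIdeal (Localization.AtPrime 𝔮 ⧸ 𝔞)).comap φ := by
    rw [h1]
    exact Ideal.map_comap_of_surjective _ ē.surjective _
  have h3 := RingEquiv.height_map (R := MvPolynomial σ (Localization.AtPrime 𝔭) ⧸ 𝔪T)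
    (S := MvPolynomial σ (ResidueField (Localization.AtPrime 𝔭))) ē
    (𝔔R.map (Ideal.Quotient.mk 𝔪T))
  rw [h2] at h3
  -- ### the count
  rw [← h3] at hgd
  obtain ⟨b, hb⟩ := ENat.ne_top_iff_exists.mp
    (Ideal.height_ne_top_of_isPrime (I := (maximalIdeal (Localization.AtPrime 𝔮 ⧸ 𝔞)).comap φ))
  rw [← hb] at hgd hμ₂
  rw [hht, hgd] at ha𝔔
  have e3 : a𝔔 = d + b := by exact_mod_cast ha𝔔
  have e4 : (maximalIdeal (Localization.AtPrime 𝔮 ⧸ 𝔞)).spanFinrank + I₀.card ≤ b := by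
    exact_mod_cast hμ₂
  apply IsRegularLocalRing.of_spanFinrank_maximalIdeal_le
  rw [IsLocalization.AtPrime.ringKrullDim_eq_height 𝔮 (Localization.AtPrime 𝔮), ← ha𝔮]
  have : (maximalIdeal (Localization.AtPrime 𝔮)).spanFinrank ≤ a𝔮 := by omega
  exact_mod_cast this

end Engine

end Summit.ResolutionOfSingularities.ResolutionOfSingularities.Theorems.PfaffLine

end
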